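import Summits.BirchSwinnertonDyer.Rank1Residual.Supersingular.KuriharaTwistSchemaLevelK
import Mathlib.Data.Nat.Squarefree
import Mathlib.Tactic.NormNum.Prime
import HarnessLib

/-!
# Twist records: `ω(n) = #primes` from the recheck plus primality of the listed primes
# (discharging the hypothesis `hν` of `TwistRecord.kuriharaNumber_ne_zero_of_consistent` and its twins)

Cell `b2b-bsdres`, supersingular family, prover A = unit `b2b-bsdres-x10b` (gen 10).  Topic file; namespace
`Summit.BirchSwinnertonDyer.Rank1Residual.Supersingular.KuriharaTwist`.  THEOREMS ONLY; nothing asserted about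
any curve; nothing booked.

HONEST FRAMING (run/shared/lean/b2b/bsd-rank1-residual/, verbatim in every file): the goal of the
cell is to DELETE the COMBINATION-SHAPED residual classes of the Birch–Swinnerton-Dyer formula for
ALL analytic-rank `≤ 1` elliptic curves over `ℚ` — "full BSD formula for every rank `≤ 1` curve in
class `C`" assembled STRICTLY from published theorems — so that the rank-`≤ 1` remainder becomes
exactly the CONSTRUCTION-SHAPED classes, which are TYPED (missing-input `Prop`s), NOT attempted.
This is not "finishing BSD".

## What this file proves

The consumers of `KuriharaTwistSymbolKurihara{,K}.lean` / `KuriharaTwistRecordAssembly.lean` carry the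
hypothesis `hν : r.n.primeFactors.card = r.primes.length` (the recheck indexes the structure congruences by
`#primes`, the identity by `ω(n)`).  `Nat.primeFactors` does not reduce by `decide`, so `hν` is not a
one-word discharge; but the recheck already verifies `n = Π primes` and `primes.Nodup`, and the primality
of the (two or three, `< 10⁶`) listed primes is a `norm_num` fact per record.  Hence:
`TwistRecord.card_primeFactors_eq_of_consistent` / `TwistRecordK.card_primeFactors_eq_of_consistent` —
`r.consistent` + `∀ ℓ ∈ r.primes, ℓ.Prime` ⟹ `ω(r.n) = #r.primes` (and `r.n.primeFactors = r.primes.toFinset`).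

References: `KuriharaTwistSchema.lean`, `KuriharaTwistSchemaLevelK.lean` (the rechecks); Mathlib
`Nat.primeFactors_prod`, `List.prod_toFinset`.
-/

namespace Summit.BirchSwinnertonDyer.Rank1Residual.Supersingular.KuriharaTwist

/-- A duplicate-free list of primes whose `foldl`-product is `n` is the list of prime factors of `n`:
`n.primeFactors = l.toFinset`. [folklore] -/
theorem primeFactors_eq_toFinset_of_foldl_eq {l : List ℕ} {n : ℕ} (hprod : l.foldl (· * ·) 1 = n)
    (hnd : l.Nodup) (hprimes : ∀ ℓ ∈ l, ℓ.Prime) : n.primeFactors = l.toFinset := by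
  have hn : n = ∏ p ∈ l.toFinset, p := by
    rw [← hprod, List.prod_toFinset _ hnd, ← List.prod_eq_foldl]
    simp
  rw [hn]
  exact Nat.primeFactors_prod (fun p hp => hprimes p (List.mem_toFinset.1 hp))

/-- … and so `ω(n) = l.length`. [folklore] -/
theorem card_primeFactors_eq_length_of_foldl_eq {l : List ℕ} {n : ℕ} (hprod : l.foldl (· * ·) 1 = n)
    (hnd : l.Nodup) (hprimes : ∀ ℓ ∈ l, ℓ.Prime) : n.primeFactors.card = l.length := by
  rw [primeFactors_eq_toFinset_of_foldl_eq hprod hnd hprimes, List.toFinset_card_of_nodup hnd]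

/-- **`ω(r.n) = #r.primes` for a consistent twist record whose listed primes are prime** (the recheck
supplies `n = Π primes` and `primes.Nodup`; primality is `norm_num` per record). [folklore] -/
theorem TwistRecord.card_primeFactors_eq_of_consistent (r : TwistRecord) (hc : r.consistent = true)
    (hprimes : ∀ ℓ ∈ r.primes, ℓ.Prime) : r.n.primeFactors.card = r.primes.length := by
  have hc' := hc
  simp only [TwistRecord.consistent, Bool.and_eq_true, decide_eq_true_eq, beq_iff_eq] at hc'
  exact card_primeFactors_eq_length_of_foldl_eq hc'.1.1.1.1.1.1.1.1.1.1.1.1.1.2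
    hc'.1.1.1.1.1.1.1.1.1.1.1.2 hprimes

/-- `r.n.primeFactors = r.primes.toFinset` for such a record. [folklore] -/
theorem TwistRecord.primeFactors_eq_of_consistent (r : TwistRecord) (hc : r.consistent = true)
    (hprimes : ∀ ℓ ∈ r.primes, ℓ.Prime) : r.n.primeFactors = r.primes.toFinset := by
  have hc' := hc
  simp only [TwistRecord.consistent, Bool.and_eq_true, decide_eq_true_eq, beq_iff_eq] at hc'
  exact primeFactors_eq_toFinset_of_foldl_eq hc'.1.1.1.1.1.1.1.1.1.1.1.1.1.2
    hc'.1.1.1.1.1.1.1.1.1.1.1.2 hprimes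

/-- **`ω(r.n) = #r.primes` for a consistent DEPTH-`k` twist record whose listed primes are prime.** [folklore] -/
theorem TwistRecordK.card_primeFactors_eq_of_consistent (r : TwistRecordK) (hc : r.consistent = true)
    (hprimes : ∀ ℓ ∈ r.primes, ℓ.Prime) : r.n.primeFactors.card = r.primes.length := by
  have hc' := hc
  simp only [TwistRecordK.consistent, Bool.and_eq_true, decide_eq_true_eq, beq_iff_eq] at hc'
  exact card_primeFactors_eq_length_of_foldl_eq hc'.1.1.1.1.1.1.1.1.1.1.1.1.1.1.1.2
    hc'.1.1.1.1.1.1.1.1.1.1.1.1.1.2 hprimes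

/-- The schema SAMPLE record (`43314b1` @ `5`, `n = 10291 = 41·251`): `ω(10291) = 2`, discharged from the
recheck and `norm_num` primality of `41`, `251`. [folklore] -/
theorem card_primeFactors_sample :
    (10291 : ℕ).primeFactors.card = 2 :=
  card_primeFactors_eq_length_of_foldl_eq (l := [41, 251]) (by decide) (by decide)
    (by intro ℓ hℓ; simp only [List.mem_cons, List.mem_nil_iff, or_false] at hℓ
        rcases hℓ with rfl | rfl <;> norm_num)

end Summit.BirchSwinnertonDyer.Rank1Residual.Supersingular.KuriharaTwist
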